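import Summits.QuantumFields.BalabanUV.Beta.GAN24.DressedStepFaceCharges
import Summits.QuantumFields.BalabanUV.Beta.GAN24.PeriodicKKTResponseFlux
import Summits.QuantumFields.BalabanUV.Beta.GAN24.CoProjBmDivFree
import Summits.QuantumFields.BalabanUV.Beta.RelInvBorderedHessian
import Literature.MathematicalPhysics.QuantumFieldTheory.Balaban1983to89.Beta.ResolventCompositionStepB

/-!
# `BalabanUV.Beta.GAN24.DressedKernelOnCurrent` — binder row G-an2-4 ∕ (CONV-C), W-slot CT-W, conservation law (C)∕(C)sym, step (P5)(II-d)∕(E3)–(E4) of this lineage's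
# note `HOME/b2b-balaban-gan24-formalise-leaf-04/g65/CSYM-LEVEL0-KERNEL-BLUEPRINT.md` §4: **THE CO-DRESSED KERNEL `Πkᵀ∘K∘Πk` APPLIED TO A BOUNDED 1-FORM —
# `(Πᵀ K Π)_ff·t = Π_bm (K_ff·(Πᵀ_bm t))`, `(Πᵀ K Π)_mf·t = K_mf·(Πᵀ_bm t)` — THE CELL ADJOINTNESS `⟨J, Π_bm A⟩_cell = ⟨Πᵀ_bm J, A⟩_cell`, AND THE LEVEL-0 INSTANCE:
# on a block-periodic divergence-free CURRENT the multiplier rows of `unitK s_f s_m (coDressKBmAt ρ Lc (KInvStep Lc 0))` VANISH (zero cell totals: fact (d1)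
# «Φ = 0») and its field rows are `s_f²·Π_bm` of the `Γ_{Lc}`-response of `GAN24.PeriodicKKTResponse`**

NOT IN PRINT; OUR BOOKKEEPING ([folklore] window ∕ lattice-sum bookkeeping BY NAME over an2's `AxialDressingRooted.piKBm ∕ pmBm ∕ cube ∕ coProjBmW ∕ coProjBmAt ∕ coDressKBmAt ∕
pmBm_shift ∕ abs_pmBm_le ∕ tsum_window'`, this lineage's `HarmonicPeriodicTwoForm.sum_box_shift`, the sibling `DressedStepFaceCharges.comp_trK_piKBm_inr ∕ coDressKBmAt_inr_inl`,
leaf-02's `GAN24.CoProjBmDivFree.coProjBmAt_eq_self_of_divFree` (`Πᵀ_bm` fixes divergence-free forms), an2's `OneStepResolventKernel.KInv_inl_inl ∕ KInv_inr_inl_coarse ∕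
KInv_inr_off ∕ eq_zsmul_quo_of_proj`, an4's `HessianTelescopingKKT.kInvStep_zero`, `OneStepKernelFamily.decays_KInvStep`, and this lineage's `PeriodicForceMultiplier.bounded_of_periodic`
∕ `PeriodicKKTResponseFlux.tsum_mul_GamΦ_eq_zero`; G-an2-4 formalisation swarm, leaf prover `b2b-balaban-gan24-formalise-leaf-04`, gen 65).  HONEST FRAMING (cell contract,
verbatim): «discharging `BetaPertH` makes Bałaban's UV stability UNCONDITIONAL — a real constructive-QFT result; it is NOT the continuum limit and NOT the Clay problem.»
HONEST DEPENDENCY (verbatim): «continuum YM on T⁴ ⇐ BetaPertH ∧ nine spine estimates (0/9 proved); BetaPertH ⇐ (D1) ∧ (D4) ∧ CAP+tail; G-an2-4 gates asym, D1 and NE2/3/4.»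

WHY (blueprint §4 (E3)–(E4)): in the EE exchange word of the dressed one-step source the background-summed right half-vertex is the block-periodic EDGE CURRENT `J′`
(`DressedHalfVertex` + `WilsonFaceHalfVertex`); the dressed step kernel `X̃♮_0 = unitK s_f s_m (Πkᵀ∘KInvStep Lc 0∘Πk)` acts on it: its MULTIPLIER rows see `Γ^Φ·(Πᵀ_bm J′) =
Γ^Φ·J′ = 0` (a current has zero cell totals — THIS is where «Φ = 0» enters), its FIELD rows give `s_f²·Π_bm (Γ_{Lc}·J′)`; paired over one cell with the left current `J`
(`CovariantFamilyCellPairing`), `⟨J, Π_bm A′⟩_cell = ⟨Πᵀ_bm J, A′⟩_cell = ⟨J, A′⟩_cell` (§1 + `CoProjBmDivFree`) lands on `PeriodicKKTExchangePairing.card_mul_pairing_plaq`.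

WHAT ([folklore]; 0 `def`, 0 cited facts, 0 `def … : Prop`, 0 sorry): §1 **`sum_box_mul_coProjBmW`** (cell adjointness, any root `ρ`, `1 ≤ N`, block-periodic `J A`);
§2 `comp_trK_piKBm_inl`, **`coDressKBmAt_inl_inl`** (two-window form of the field block), `tsum_sum_window_shift`, **`tsum_coDressKBmAt_inl_inl_mul`** (`(Πᵀ K Π)_ff·t =
coProjBmW ρ N (K_ff·(coProjBmAt ρ N t))` for summable field rows, bounded `t`, in-block root), **`tsum_coDressKBmAt_inr_inl_mul`** (`(Πᵀ K Π)_mf·t = K_mf·(coProjBmAt ρ N t)`); §3 (level 0,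
in-block root, all units; `BorderedHessian.KInvStep_zero_eq` and an5's `ResolventCompositionStepB.sum4_comm` BY NAME) `summable_row`, **`tsum_dressedStep_zero_inr_mul_current`** (`= 0` on a block-periodic
divergence-free `t` with zero cell totals), **`tsum_dressedStep_zero_inl_mul_current`** (`= s_f²·coProjBmW ρ Lc (fun κ u => Σ'_{u′} Σ_{κ′} t κ′ u′·Γ_{Lc} κ u κ′ u′) a x` on a block-periodic
divergence-free `t`).  Asserts NO value of Bałaban's tables; discharges NOTHING of (C)sym ∕ (Q-D) ∕ (Q-D-rate) ∕ «T2Shape» ∕ «T2Drift» ∕ (hW, hWall); NEVER «G-an2-4 closed» as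
(CONV-C); NOT D1, NOT `BetaPertH`, NOT continuum, NOT Clay.  2026-08-22; no existing file touched.
-/

noncomputable section

open Finset
open scoped BigOperators
open Literature.MathematicalPhysics.QuantumFieldTheory
open Literature.MathematicalPhysics.QuantumFieldTheory.Balaban1983to89
open Literature.MathematicalPhysics.QuantumFieldTheory.Balaban1983to89.Beta
open ExpKernelCalculus (Site MKer comp)
open OneStepResolventKernel (Fib)
open AffineAveraging (Form1 box toSite)
open PeriodicDescent (IsPeriodic)
open Summit.QuantumFields.BalabanUV.Beta.TameKernelCalculus (trK)
open Summit.QuantumFields.BalabanUV.Beta.AxialDressingRooted (piKBm pmBm cube coProjBmW coProjBmW_apply coProjBmAt coProjBmAt_apply coDressKBmAt coDressKBmAt_eq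
  comp_piKBm_inr piKBm_inl_inl piKBm_inl_inr piKBm_inr_inl piKBm_inr_inr sum_piKBm_col_inl tsum_window' pmBm_shift abs_pmBm_le)
open Summit.QuantumFields.BalabanUV.Beta.GAN24.DressedStepFaceCharges (comp_trK_piKBm_inr coDressKBmAt_inr_inl)
open Summit.QuantumFields.BalabanUV.Beta.GAN24.HarmonicPeriodicTwoForm (sum_box_shift)
open B12Sec2to5 (l1)
open ExpKernelCalculus (Decays summable_exp_shift)
open Literature.Probability.LatticeModels (Torus.proj)
open LatticeForm (quo)
open OneStepResolventKernel (KInv KInv_inl_inl KInv_inr_inl_coarse KInv_inr_off eq_zsmul_quo_of_proj)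
open OneStepKernelFamily (KInvStep decays_KInvStep)
open KKTFluctuationKernel (Gam GamΦ)
open AffineAveraging (unitVec)
open Summit.QuantumFields.BalabanUV.Beta.HessKerDressedUnits (unitK unitK_apply legScale_inl legScale_inr)
open Summit.QuantumFields.BalabanUV.Beta.GAN24.CoProjBmDivFree (coProjBmAt_eq_self_of_divFree)
open Summit.QuantumFields.BalabanUV.Beta.BorderedHessian (KInvStep_zero_eq)
open Summit.QuantumFields.BalabanUV.Beta.GAN24.PeriodicForceMultiplier (bounded_of_periodic)
open Summit.QuantumFields.BalabanUV.Beta.GAN24.PeriodicKKTResponseFlux (tsum_mul_GamΦ_eq_zero)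

namespace Summit.QuantumFields.BalabanUV.Beta.GAN24.DressedKernelOnCurrent

variable {d : ℕ} {N : ℕ}

/-! ## §1 Cell adjointness of the window matrix: `⟨J, Π_bm A⟩_cell = ⟨Πᵀ_bm J, A⟩_cell` for block-periodic `J`, `A` -/

/-- [folklore] **CELL ADJOINTNESS OF `Π_bm` ∕ `Πᵀ_bm` ON BLOCK-PERIODIC 1-FORMS** (any root `ρ`, `1 ≤ N`): for `N`-periodic `J`, `A`,
`Σ_{r ∈ box} Σ_a J a (toSite r)·(coProjBmW ρ N A) a (toSite r) = Σ_{r ∈ box} Σ_a (coProjBmAt ρ N J) a (toSite r)·A a (toSite r)` (`coProjBmW = Π_bm` as the window matrix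
`pmBm`, `coProjBmAt = Πᵀ_bm`; coarse covariance `pmBm_shift` and the cell shift `HarmonicPeriodicTwoForm.sum_box_shift`). -/
theorem sum_box_mul_coProjBmW (ρ : Fin (d + 1) → ℤ) (hN : 1 ≤ N) [NeZero N] {J A : Form1 (d + 1) ℝ} (hJ : ∀ a, IsPeriodic N (J a)) (hA : ∀ a, IsPeriodic N (A a)) :
    ∑ r ∈ box (d + 1) N, ∑ a, J a (toSite r) * coProjBmW ρ N A a (toSite r) =
      ∑ r ∈ box (d + 1) N, ∑ a, coProjBmAt ρ N J a (toSite r) * A a (toSite r) := by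
  simp only [coProjBmW_apply, coProjBmAt_apply, Finset.mul_sum, Finset.sum_mul]
  -- the summands
  set f : (Fin (d + 1) → ℕ) → Fin (d + 1) → Site (d + 1) → Fin (d + 1) → ℝ := fun r a v κ =>
    J a (toSite r) * (pmBm ρ N a (toSite r) κ (toSite r - v) * A κ (toSite r - v)) with hf
  set g : (Fin (d + 1) → ℕ) → Fin (d + 1) → Site (d + 1) → Fin (d + 1) → ℝ := fun r a v β =>
    pmBm ρ N β (toSite r + v) a (toSite r) * J β (toSite r + v) * A a (toSite r) with hg
  -- the cell shift: for fixed directions and window offset, the two cell sums agree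
  have key : ∀ (β a : Fin (d + 1)) (v : Site (d + 1)), ∑ r ∈ box (d + 1) N, g r a v β = ∑ r ∈ box (d + 1) N, f r β v a := by
    intro β a v
    have hper : IsPeriodic N (fun q => pmBm ρ N β (q + v) a q * J β (q + v) * A a q) := by
      intro q t
      show pmBm ρ N β (q + (N : ℤ) • t + v) a (q + (N : ℤ) • t) * J β (q + (N : ℤ) • t + v) * A a (q + (N : ℤ) • t) =
        pmBm ρ N β (q + v) a q * J β (q + v) * A a q
      rw [show q + (N : ℤ) • t + v = (q + v) + (N : ℤ) • t by abel, pmBm_shift ρ hN, hJ, hA]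
    have e := sum_box_shift (N := N) hper (-v)
    show ∑ r ∈ box (d + 1) N, pmBm ρ N β (toSite r + v) a (toSite r) * J β (toSite r + v) * A a (toSite r) =
      ∑ r ∈ box (d + 1) N, J β (toSite r) * (pmBm ρ N β (toSite r) a (toSite r - v) * A a (toSite r - v))
    rw [← e]
    refine Finset.sum_congr rfl fun r _ => ?_
    show pmBm ρ N β (toSite r + -v + v) a (toSite r + -v) * J β (toSite r + -v + v) * A a (toSite r + -v) = _
    rw [show toSite r + -v + v = toSite r by abel, ← sub_eq_add_neg]
    ring
  show ∑ r ∈ box (d + 1) N, ∑ a, ∑ v ∈ cube (d + 1) N, ∑ κ, f r a v κ = ∑ r ∈ box (d + 1) N, ∑ a, ∑ v ∈ cube (d + 1) N, ∑ β, g r a v β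
  -- both sides as `Σ_a Σ_κ Σ_v Σ_r f r a v κ`
  have hL : ∑ r ∈ box (d + 1) N, ∑ a, ∑ v ∈ cube (d + 1) N, ∑ κ, f r a v κ = ∑ a : Fin (d + 1), ∑ κ : Fin (d + 1), ∑ v ∈ cube (d + 1) N, ∑ r ∈ box (d + 1) N, f r a v κ := by
    rw [Finset.sum_comm]
    refine Finset.sum_congr rfl fun a _ => ?_
    calc ∑ r ∈ box (d + 1) N, ∑ v ∈ cube (d + 1) N, ∑ κ, f r a v κ
        = ∑ r ∈ box (d + 1) N, ∑ κ, ∑ v ∈ cube (d + 1) N, f r a v κ := Finset.sum_congr rfl fun r _ => Finset.sum_comm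
      _ = ∑ κ, ∑ r ∈ box (d + 1) N, ∑ v ∈ cube (d + 1) N, f r a v κ := Finset.sum_comm
      _ = ∑ κ, ∑ v ∈ cube (d + 1) N, ∑ r ∈ box (d + 1) N, f r a v κ := Finset.sum_congr rfl fun κ _ => Finset.sum_comm
  have hR : ∑ r ∈ box (d + 1) N, ∑ a, ∑ v ∈ cube (d + 1) N, ∑ β, g r a v β = ∑ a : Fin (d + 1), ∑ κ : Fin (d + 1), ∑ v ∈ cube (d + 1) N, ∑ r ∈ box (d + 1) N, f r a v κ := by
    -- first to `Σ_a Σ_β Σ_v Σ_r g`, then `key`, then rename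
    have h1 : ∑ r ∈ box (d + 1) N, ∑ a, ∑ v ∈ cube (d + 1) N, ∑ β, g r a v β = ∑ a : Fin (d + 1), ∑ β : Fin (d + 1), ∑ v ∈ cube (d + 1) N, ∑ r ∈ box (d + 1) N, g r a v β := by
      rw [Finset.sum_comm]
      refine Finset.sum_congr rfl fun a _ => ?_
      calc ∑ r ∈ box (d + 1) N, ∑ v ∈ cube (d + 1) N, ∑ β, g r a v β
          = ∑ r ∈ box (d + 1) N, ∑ β, ∑ v ∈ cube (d + 1) N, g r a v β := Finset.sum_congr rfl fun r _ => Finset.sum_comm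
        _ = ∑ β, ∑ r ∈ box (d + 1) N, ∑ v ∈ cube (d + 1) N, g r a v β := Finset.sum_comm
        _ = ∑ β, ∑ v ∈ cube (d + 1) N, ∑ r ∈ box (d + 1) N, g r a v β := Finset.sum_congr rfl fun β _ => Finset.sum_comm
    rw [h1]
    simp_rw [key]
    -- now `Σ_a Σ_β Σ_v Σ_r f r β v a`; swap the two direction binders
    exact Finset.sum_comm
  rw [hL, hR]

/-! ## §2 The co-dressed kernel applied to a bounded 1-form: `(Πᵀ K Π)_ff·t = Π_bm (K_ff·(Πᵀ_bm t))`, `(Πᵀ K Π)_mf·t = K_mf·(Πᵀ_bm t)` -/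

section Apply

variable (ρ : Fin (d + 1) → ℤ) (N)

/-- [folklore] Left composition with `Πᵀ = trK (piKBm ρ N)` on a FIELD row, window form: `(Πᵀ ∘ K) x u′ (inl a) g′ = Σ_{v ∈ cube} Σ_κ pmBm ρ N a x κ (x − v)·K (x − v) u′ (inl κ) g′`. -/
theorem comp_trK_piKBm_inl (K : MKer (d + 1) (Fib d)) (x u' : Site (d + 1)) (a : Fin (d + 1)) (g' : Fib d) :
    comp (trK (piKBm ρ N)) K x u' (Sum.inl a) g' = ∑ v ∈ cube (d + 1) N, ∑ κ : Fin (d + 1), pmBm ρ N a x κ (x - v) * K (x - v) u' (Sum.inl κ) g' := by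
  unfold ExpKernelCalculus.comp
  have h : ∀ u, ∑ g : Fib d, trK (piKBm ρ N) x u (Sum.inl a) g * K u u' g g' =
      if x - u ∈ cube (d + 1) N then ∑ κ : Fin (d + 1), pmBm ρ N a x κ u * K u u' (Sum.inl κ) g' else 0 := by
    intro u
    have e : ∀ g : Fib d, trK (piKBm ρ N) x u (Sum.inl a) g = piKBm ρ N u x g (Sum.inl a) := fun g => rfl
    simp_rw [e]
    exact sum_piKBm_col_inl ρ N u x a (fun g => K u u' g g')
  simp_rw [h]
  rw [tsum_window']

/-- [folklore] **THE FIELD–FIELD ENTRIES OF THE CO-DRESSED KERNEL, WINDOW FORM** (both legs): `(Πᵀ K Π) x z (inl a) (inl b) =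
Σ_{v ∈ cube} Σ_κ Σ_{v′ ∈ cube} Σ_{κ′} pmBm ρ N a x κ (x − v) · K (x − v) (z − v′) (inl κ) (inl κ′) · pmBm ρ N b z κ′ (z − v′)`. -/
theorem coDressKBmAt_inl_inl (K : MKer (d + 1) (Fib d)) (x z : Site (d + 1)) (a b : Fin (d + 1)) :
    coDressKBmAt ρ N K x z (Sum.inl a) (Sum.inl b) =
      ∑ v ∈ cube (d + 1) N, ∑ κ : Fin (d + 1), ∑ v' ∈ cube (d + 1) N, ∑ κ' : Fin (d + 1),
        pmBm ρ N a x κ (x - v) * K (x - v) (z - v') (Sum.inl κ) (Sum.inl κ') * pmBm ρ N b z κ' (z - v') := by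
  rw [coDressKBmAt_eq]
  -- the outer composition with `Π` on the right, window form
  have hout : comp (comp (trK (piKBm ρ N)) K) (piKBm ρ N) x z (Sum.inl a) (Sum.inl b) =
      ∑ v' ∈ cube (d + 1) N, ∑ κ' : Fin (d + 1), comp (trK (piKBm ρ N)) K x (z - v') (Sum.inl a) (Sum.inl κ') * pmBm ρ N b z κ' (z - v') := by
    unfold ExpKernelCalculus.comp
    have h : ∀ u', ∑ g' : Fib d, (∑' u, ∑ g : Fib d, trK (piKBm ρ N) x u (Sum.inl a) g * K u u' g g') * piKBm ρ N u' z g' (Sum.inl b) =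
        if z - u' ∈ cube (d + 1) N then ∑ κ' : Fin (d + 1),
          (∑' u, ∑ g : Fib d, trK (piKBm ρ N) x u (Sum.inl a) g * K u u' g (Sum.inl κ')) * pmBm ρ N b z κ' u' else 0 := by
      intro u'
      rw [Fintype.sum_sum_type]
      simp only [piKBm_inl_inl, piKBm_inr_inl, mul_zero, Finset.sum_const_zero, add_zero]
      split_ifs with hw
      · rfl
      · simp
    simp_rw [h]
    rw [tsum_window']
  rw [hout]
  simp_rw [comp_trK_piKBm_inl]
  simp only [Finset.sum_mul]
  exact ResolventCompositionStepB.sum4_comm _ _ _ _ (fun v' κ' v κ => pmBm ρ N a x κ (x - v) * K (x - v) (z - v') (Sum.inl κ) (Sum.inl κ') * pmBm ρ N b z κ' (z - v'))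

variable {ρ N}

/-- [folklore] A window re-indexing: `Σ'_z Σ_{v′ ∈ cube} G (z − v′) v′ z = Σ'_u Σ_{v′ ∈ cube} G u v′ (u + v′)` for a family summable in `z` at each `v′`. -/
theorem tsum_sum_window_shift {G : Site (d + 1) → Site (d + 1) → Site (d + 1) → ℝ} (hG : ∀ v', Summable fun z => G (z - v') v' z) :
    ∑' z, ∑ v' ∈ cube (d + 1) N, G (z - v') v' z = ∑' u, ∑ v' ∈ cube (d + 1) N, G u v' (u + v') := by
  rw [Summable.tsum_finsetSum (fun v' _ => hG v')]
  have hG' : ∀ v', Summable fun u => G u v' (u + v') := by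
    intro v'
    have e := (Equiv.addRight v').summable_iff.2 (hG v')
    refine e.congr fun u => ?_
    simp [Equiv.addRight]
  rw [Summable.tsum_finsetSum (fun v' _ => hG' v')]
  refine Finset.sum_congr rfl fun v' _ => ?_
  rw [← (Equiv.addRight v').tsum_eq (fun z => G (z - v') v' z)]
  refine tsum_congr fun u => ?_
  simp [Equiv.addRight]

/-- [folklore] **THE CO-DRESSED KERNEL ON A BOUNDED 1-FORM, FIELD ROWS**: for `K` with summable field rows and `t` bounded,
`Σ'_z Σ_b (Πᵀ K Π) x z (inl a) (inl b)·t b z = coProjBmW ρ N (fun κ u => Σ'_{u′} Σ_{κ′} K u u′ (inl κ) (inl κ′)·coProjBmAt ρ N t κ′ u′) a x` — `Π_bm (K_ff·(Πᵀ_bm t))` (in-block root,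
`1 ≤ N`: `|pmBm| ≤ 1 + 4(d+1)N`). -/
theorem tsum_coDressKBmAt_inl_inl_mul (hN : 1 ≤ N) {r : Fin (d + 1) → ℕ} (hr : r ∈ box (d + 1) N) {K : MKer (d + 1) (Fib d)}
    (hK : ∀ x (a b : Fin (d + 1)), Summable fun z => K x z (Sum.inl a) (Sum.inl b)) {t : Form1 (d + 1) ℝ} {B : ℝ} (ht : ∀ b z, |t b z| ≤ B)
    (x : Site (d + 1)) (a : Fin (d + 1)) :
    ∑' z, ∑ b, coDressKBmAt (toSite r) N K x z (Sum.inl a) (Sum.inl b) * t b z =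
      coProjBmW (toSite r) N (fun κ u => ∑' u', ∑ κ', K u u' (Sum.inl κ) (Sum.inl κ') * coProjBmAt (toSite r) N t κ' u') a x := by
  have hB : 0 ≤ B := (abs_nonneg _).trans (ht 0 0)
  set P : ℝ := 1 + 4 * (((d : ℝ) + 1) * N) with hP
  have hPn : 0 ≤ P := by rw [hP]; positivity
  -- each `(v, κ)`-window term of the row is a summable function of `z`
  have hsv : ∀ (v : Site (d + 1)) (κ : Fin (d + 1)) (v' : Site (d + 1)) (κ' b : Fin (d + 1)), Summable fun z : Site (d + 1) =>
      pmBm (toSite r) N a x κ (x - v) * K (x - v) (z - v') (Sum.inl κ) (Sum.inl κ') * pmBm (toSite r) N b z κ' (z - v') * t b z := by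
    intro v κ v' κ' b
    have hs : Summable fun z : Site (d + 1) => K (x - v) (z - v') (Sum.inl κ) (Sum.inl κ') :=
      ((Equiv.subRight v').summable_iff.2 (hK (x - v) κ κ')).congr fun z => by simp [Equiv.subRight]
    refine Summable.of_norm_bounded ((hs.abs.mul_left (|pmBm (toSite r) N a x κ (x - v)|)).mul_right (P * B)) (fun z => ?_)
    rw [Real.norm_eq_abs, abs_mul, abs_mul, abs_mul]
    have e1 := abs_pmBm_le hN hr b z κ' (z - v')
    have e2 := ht b z
    have h0 : 0 ≤ |pmBm (toSite r) N a x κ (x - v)| * |K (x - v) (z - v') (Sum.inl κ) (Sum.inl κ')| := by positivity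
    calc |pmBm (toSite r) N a x κ (x - v)| * |K (x - v) (z - v') (Sum.inl κ) (Sum.inl κ')| * |pmBm (toSite r) N b z κ' (z - v')| * |t b z|
        = (|pmBm (toSite r) N a x κ (x - v)| * |K (x - v) (z - v') (Sum.inl κ) (Sum.inl κ')|) * (|pmBm (toSite r) N b z κ' (z - v')| * |t b z|) := by ring
      _ ≤ (|pmBm (toSite r) N a x κ (x - v)| * |K (x - v) (z - v') (Sum.inl κ) (Sum.inl κ')|) * (P * B) :=
          mul_le_mul_of_nonneg_left (mul_le_mul e1 e2 (abs_nonneg _) hPn) h0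
  -- expand and interchange the `z`-sum with the finite window sums
  have e1 : ∀ z, ∑ b, coDressKBmAt (toSite r) N K x z (Sum.inl a) (Sum.inl b) * t b z =
      ∑ v ∈ cube (d + 1) N, ∑ κ : Fin (d + 1), ∑ v' ∈ cube (d + 1) N, ∑ κ' : Fin (d + 1), ∑ b,
        pmBm (toSite r) N a x κ (x - v) * K (x - v) (z - v') (Sum.inl κ) (Sum.inl κ') * pmBm (toSite r) N b z κ' (z - v') * t b z := by
    intro z
    simp only [coDressKBmAt_inl_inl, Finset.sum_mul]
    rw [Finset.sum_comm]
    refine Finset.sum_congr rfl fun v _ => ?_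
    rw [Finset.sum_comm]
    refine Finset.sum_congr rfl fun κ _ => ?_
    rw [Finset.sum_comm]
    refine Finset.sum_congr rfl fun v' _ => ?_
    rw [Finset.sum_comm]
  rw [tsum_congr e1]
  rw [Summable.tsum_finsetSum (fun v _ => summable_sum fun κ _ => summable_sum fun v' _ => summable_sum fun κ' _ => summable_sum fun b _ => hsv v κ v' κ' b)]
  rw [coProjBmW_apply]
  refine Finset.sum_congr rfl fun v _ => ?_
  rw [Summable.tsum_finsetSum (fun κ _ => summable_sum fun v' _ => summable_sum fun κ' _ => summable_sum fun b _ => hsv v κ v' κ' b)]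
  refine Finset.sum_congr rfl fun κ _ => ?_
  have e2 : ∑' z, ∑ v' ∈ cube (d + 1) N, ∑ κ' : Fin (d + 1), ∑ b, pmBm (toSite r) N a x κ (x - v) * K (x - v) (z - v') (Sum.inl κ) (Sum.inl κ') *
      pmBm (toSite r) N b z κ' (z - v') * t b z =
      ∑' u', ∑ v' ∈ cube (d + 1) N, ∑ κ' : Fin (d + 1), ∑ b, pmBm (toSite r) N a x κ (x - v) * K (x - v) u' (Sum.inl κ) (Sum.inl κ') *
      pmBm (toSite r) N b (u' + v') κ' u' * t b (u' + v') :=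
    tsum_sum_window_shift (N := N) (G := fun u v' z => ∑ κ' : Fin (d + 1), ∑ b, pmBm (toSite r) N a x κ (x - v) *
      K (x - v) u (Sum.inl κ) (Sum.inl κ') * pmBm (toSite r) N b z κ' u * t b z)
      (fun v' => summable_sum fun κ' _ => summable_sum fun b _ => hsv v κ v' κ' b)
  rw [e2]
  show _ = pmBm (toSite r) N a x κ (x - v) * ∑' u', ∑ κ', K (x - v) u' (Sum.inl κ) (Sum.inl κ') * coProjBmAt (toSite r) N t κ' u'
  rw [← tsum_mul_left]
  refine tsum_congr fun u' => ?_
  simp only [coProjBmAt_apply, Finset.mul_sum]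
  conv_lhs => rw [Finset.sum_comm]
  exact Finset.sum_congr rfl fun κ' _ => Finset.sum_congr rfl fun v' _ => Finset.sum_congr rfl fun b _ => by ring

/-- [folklore] **THE CO-DRESSED KERNEL ON A BOUNDED 1-FORM, MULTIPLIER ROWS**: `Σ'_z Σ_b (Πᵀ K Π) x z (inr m) (inl b)·t b z = Σ'_{u′} Σ_{κ′} K x u′ (inr m) (inl κ′)·coProjBmAt ρ N t κ′ u′`
— `K_mf·(Πᵀ_bm t)` (the multiplier rows are not dressed on the left: `Πᵀ` is the identity there). -/
theorem tsum_coDressKBmAt_inr_inl_mul (hN : 1 ≤ N) {r : Fin (d + 1) → ℕ} (hr : r ∈ box (d + 1) N) {K : MKer (d + 1) (Fib d)}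
    (hK : ∀ x (m b : Fin (d + 1)), Summable fun z => K x z (Sum.inr m) (Sum.inl b)) {t : Form1 (d + 1) ℝ} {B : ℝ} (ht : ∀ b z, |t b z| ≤ B)
    (x : Site (d + 1)) (m : Fin (d + 1)) :
    ∑' z, ∑ b, coDressKBmAt (toSite r) N K x z (Sum.inr m) (Sum.inl b) * t b z =
      ∑' u', ∑ κ', K x u' (Sum.inr m) (Sum.inl κ') * coProjBmAt (toSite r) N t κ' u' := by
  have hB : 0 ≤ B := (abs_nonneg _).trans (ht 0 0)
  set P : ℝ := 1 + 4 * (((d : ℝ) + 1) * N) with hP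
  have hPn : 0 ≤ P := by rw [hP]; positivity
  have hsv : ∀ (v' : Site (d + 1)) (κ' b : Fin (d + 1)), Summable fun z : Site (d + 1) =>
      K x (z - v') (Sum.inr m) (Sum.inl κ') * pmBm (toSite r) N b z κ' (z - v') * t b z := by
    intro v' κ' b
    have hs : Summable fun z : Site (d + 1) => K x (z - v') (Sum.inr m) (Sum.inl κ') :=
      ((Equiv.subRight v').summable_iff.2 (hK x m κ')).congr fun z => by simp [Equiv.subRight]
    refine Summable.of_norm_bounded (hs.abs.mul_right (P * B)) (fun z => ?_)
    rw [Real.norm_eq_abs, abs_mul, abs_mul, mul_assoc]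
    exact mul_le_mul_of_nonneg_left (mul_le_mul (abs_pmBm_le hN hr b z κ' (z - v')) (ht b z) (abs_nonneg _) hPn) (abs_nonneg _)
  have e1 : ∀ z, ∑ b, coDressKBmAt (toSite r) N K x z (Sum.inr m) (Sum.inl b) * t b z =
      ∑ v' ∈ cube (d + 1) N, ∑ κ' : Fin (d + 1), ∑ b, K x (z - v') (Sum.inr m) (Sum.inl κ') * pmBm (toSite r) N b z κ' (z - v') * t b z := by
    intro z
    simp only [coDressKBmAt_inr_inl, Finset.sum_mul]
    rw [Finset.sum_comm]
    refine Finset.sum_congr rfl fun v' _ => ?_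
    rw [Finset.sum_comm]
  rw [tsum_congr e1]
  have e2 := tsum_sum_window_shift (N := N) (G := fun u v' z => ∑ κ' : Fin (d + 1), ∑ b, K x u (Sum.inr m) (Sum.inl κ') *
      pmBm (toSite r) N b z κ' u * t b z) (fun v' => summable_sum fun κ' _ => summable_sum fun b _ => hsv v' κ' b)
  rw [e2]
  refine tsum_congr fun u' => ?_
  simp only [coProjBmAt_apply, Finset.mul_sum]
  conv_lhs => rw [Finset.sum_comm]
  exact Finset.sum_congr rfl fun κ' _ => Finset.sum_congr rfl fun v' _ => Finset.sum_congr rfl fun b _ => by ring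

end Apply

/-! ## §3 The W-slot instance at level 0: the dressed step kernel applied to a block-periodic current -/

section LevelZero

variable {Lc : ℕ} [NeZero Lc] {r : Fin (d + 1) → ℕ}

/-- [folklore] The rows of a decaying kernel are summable. -/
theorem summable_row {K : MKer (d + 1) (Fib d)} {C δ : ℝ} (hK : Decays K C δ) (hδ : 0 < δ) (x : Site (d + 1)) (a b : Fib d) :
    Summable fun z => K x z a b :=
  Summable.of_norm_bounded ((summable_exp_shift hδ x).mul_left C) (fun z => by rw [Real.norm_eq_abs]; exact hK x z a b)

/-- [folklore] **THE MULTIPLIER ROWS OF THE DRESSED STEP KERNEL AT LEVEL 0 KILL A BLOCK-PERIODIC DIVERGENCE-FREE CURRENT WITH ZERO CELL TOTALS** (in-block root,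
`1 ≤ Lc`, all units): for `t` with `t β (q + Lc•s) = t β q`, `Σ_β (t β p − t β (p − e_β)) = 0` and `Σ_{r ∈ box} t l (toSite r) = 0`,
`Σ'_z Σ_b (unitK s_f s_m (coDressKBmAt ρ Lc (KInvStep Lc 0))) x z (inr m) (inl b)·t b z = 0` — `Πᵀ_bm t = t` (leaf-02 `CoProjBmDivFree`), `KInvStep Lc 0 = KInv Lc`
(`RelInvBorderedHessian.KInvStep_zero_eq`), whose `(inr, inl)` block is `Γ^Φ` at the coarse points (and `0` off them), and the `Γ^Φ`-row of a force reads only its cell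
totals (`PeriodicKKTResponseFlux.tsum_mul_GamΦ_eq_zero`) — fact (d1) «Φ = 0» of note g64 §3 at its place in the exchange word. -/
theorem tsum_dressedStep_zero_inr_mul_current (hLc : 1 ≤ Lc) (hr : r ∈ box (d + 1) Lc) (sf sm : ℝ) {t : Form1 (d + 1) ℝ}
    (htp : ∀ l y s, t l (y + (Lc : ℤ) • s) = t l y) (hdiv : ∀ p : Site (d + 1), ∑ β : Fin (d + 1), (t β p - t β (p - unitVec β)) = 0)
    (h0 : ∀ l, ∑ r' ∈ box (d + 1) Lc, t l (toSite r') = 0) (x : Site (d + 1)) (m : Fin (d + 1)) :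
    ∑' z, ∑ b, unitK sf sm (coDressKBmAt (toSite r) Lc (KInvStep (d := d) Lc 0)) x z (Sum.inr m) (Sum.inl b) * t b z = 0 := by
  obtain ⟨δ, C, hδ, -, hK⟩ := decays_KInvStep (d := d) (Lc := Lc) 0
  have hB := fun b z => (bounded_of_periodic (Lc := Lc) (V := fun y => t b y) (fun y s => htp b y s) z).trans
    (Finset.single_le_sum (f := fun l => ∑ r' ∈ box (d + 1) Lc, |t l (toSite r')|) (fun l _ => Finset.sum_nonneg fun _ _ => abs_nonneg _) (Finset.mem_univ b))
  have e1 : ∀ z, ∑ b, unitK sf sm (coDressKBmAt (toSite r) Lc (KInvStep (d := d) Lc 0)) x z (Sum.inr m) (Sum.inl b) * t b z =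
      (sm * sf) * ∑ b, coDressKBmAt (toSite r) Lc (KInvStep (d := d) Lc 0) x z (Sum.inr m) (Sum.inl b) * t b z := by
    intro z
    rw [Finset.mul_sum]
    exact Finset.sum_congr rfl fun b _ => by rw [unitK_apply, legScale_inr, legScale_inl]; ring
  rw [tsum_congr e1, tsum_mul_left,
    tsum_coDressKBmAt_inr_inl_mul hLc hr (fun x m b => summable_row hK hδ x _ _) hB x m,
    coProjBmAt_eq_self_of_divFree hLc hr hdiv, KInvStep_zero_eq]
  by_cases hx : Torus.proj Lc x = 0
  · rw [eq_zsmul_quo_of_proj (N := Lc) hx]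
    simp_rw [KInv_inr_inl_coarse]
    have e2 : ∑' u', ∑ κ', GamΦ (N := Lc) m (quo Lc x) κ' u' * t κ' u' = ∑' u', ∑ κ', t κ' u' * GamΦ (N := Lc) m (quo Lc x) κ' u' :=
      tsum_congr fun u' => Finset.sum_congr rfl fun κ' _ => mul_comm _ _
    rw [e2, tsum_mul_GamΦ_eq_zero (N := Lc) hB htp h0, mul_zero]
  · simp_rw [KInv_inr_off (N := Lc) hx]
    simp

/-- [folklore] **THE FIELD ROWS OF THE DRESSED STEP KERNEL AT LEVEL 0 ON A BLOCK-PERIODIC DIVERGENCE-FREE FORM ARE `s_f²·Π_bm` OF THE `Γ_{Lc}`-RESPONSE** (in-block root,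
`1 ≤ Lc`, all units): `Σ'_z Σ_b (unitK s_f s_m (coDressKBmAt ρ Lc (KInvStep Lc 0))) x z (inl a) (inl b)·t b z = s_f²·coProjBmW ρ Lc (fun κ u => Σ'_{u′} Σ_{κ′} t κ′ u′·Γ_{Lc} κ u κ′ u′) a x`
— the superposed response of `GAN24.PeriodicKKTResponse ∕ PeriodicKKTResponseFlux` seen through the window matrix `Π_bm`. -/
theorem tsum_dressedStep_zero_inl_mul_current (hLc : 1 ≤ Lc) (hr : r ∈ box (d + 1) Lc) (sf sm : ℝ) {t : Form1 (d + 1) ℝ}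
    (htp : ∀ l y s, t l (y + (Lc : ℤ) • s) = t l y) (hdiv : ∀ p : Site (d + 1), ∑ β : Fin (d + 1), (t β p - t β (p - unitVec β)) = 0)
    (x : Site (d + 1)) (a : Fin (d + 1)) :
    ∑' z, ∑ b, unitK sf sm (coDressKBmAt (toSite r) Lc (KInvStep (d := d) Lc 0)) x z (Sum.inl a) (Sum.inl b) * t b z =
      (sf * sf) * coProjBmW (toSite r) Lc (fun κ u => ∑' u', ∑ κ', t κ' u' * Gam (N := Lc) κ u κ' u') a x := by
  obtain ⟨δ, C, hδ, -, hK⟩ := decays_KInvStep (d := d) (Lc := Lc) 0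
  have hB := fun b z => (bounded_of_periodic (Lc := Lc) (V := fun y => t b y) (fun y s => htp b y s) z).trans
    (Finset.single_le_sum (f := fun l => ∑ r' ∈ box (d + 1) Lc, |t l (toSite r')|) (fun l _ => Finset.sum_nonneg fun _ _ => abs_nonneg _) (Finset.mem_univ b))
  have e1 : ∀ z, ∑ b, unitK sf sm (coDressKBmAt (toSite r) Lc (KInvStep (d := d) Lc 0)) x z (Sum.inl a) (Sum.inl b) * t b z =
      (sf * sf) * ∑ b, coDressKBmAt (toSite r) Lc (KInvStep (d := d) Lc 0) x z (Sum.inl a) (Sum.inl b) * t b z := by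
    intro z
    rw [Finset.mul_sum]
    exact Finset.sum_congr rfl fun b _ => by rw [unitK_apply, legScale_inl, legScale_inl]; ring
  rw [tsum_congr e1, tsum_mul_left,
    tsum_coDressKBmAt_inl_inl_mul hLc hr (fun x a b => summable_row hK hδ x _ _) hB x a,
    coProjBmAt_eq_self_of_divFree hLc hr hdiv, KInvStep_zero_eq]
  congr 1
  congr 1
  funext κ u
  refine tsum_congr fun u' => Finset.sum_congr rfl fun κ' _ => ?_
  rw [KInv_inl_inl, mul_comm]

end LevelZero

end Summit.QuantumFields.BalabanUV.Beta.GAN24.DressedKernelOnCurrent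

end
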